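import Mathlib

/-!
# SoloBlind — the characteristic-2 heart of PROPOSITION Φ (fixed-point restriction is Hecke-equivariant)

Let `w` be an involution of a finite set (here `Fin n`) and `T` a matrix over `ZMod 2` commuting with
the permutation `w` (`T (w y) (w x) = T y x`). For a `w`-invariant vector `c` and a `w`-fixed index `y`,
the `y`-coordinate of `T c` only sees the `w`-FIXED coordinates of `c`: the non-fixed indices pair up as
`{x, w x}` with equal contributions `T y x * c x = T y (w x) * c (w x)`, and `z + z = 0` in `ZMod 2`.
This is exactly the step of PROPOSITION Φ (HOME/paper/theoremT.md) where characteristic 2 is used: the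
coefficient-restriction map `𝔽₂[S]^w → 𝔽₂[S^w]` intertwines `T` with the induced operator on fixed points.
-/

namespace Summit.Langlands.Langlands.Theorems

open Finset

/-- Contributions of the non-fixed indices cancel in pairs `{x, w x}` (characteristic 2). -/
theorem soloBlind_sum_nonfixed_eq_zero {n : ℕ} (w : Equiv.Perm (Fin n)) (hw : ∀ x, w (w x) = x)
    (f : Fin n → ZMod 2) (hf : ∀ x, f (w x) = f x) :
    ∑ x ∈ univ.filter (fun x => ¬ w x = x), f x = 0 := by
  refine Finset.sum_involution (fun x _ => w x) ?_ ?_ ?_ ?_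
  · intro a _
    rw [hf]
    exact CharTwo.add_self_eq_zero _
  · intro a ha _
    exact (Finset.mem_filter.mp ha).2
  · intro a ha
    rw [Finset.mem_filter]
    refine ⟨Finset.mem_univ _, ?_⟩
    rw [hw]
    intro h
    exact (Finset.mem_filter.mp ha).2 h.symm
  · intro a _
    exact hw a

/-- PROPOSITION Φ, step (a): for `w`-invariant `c` and `w`-fixed `y`, `(T c)_y = Σ_{x fixed} T_{yx} c_x`
over `ZMod 2`, whenever `T` commutes with the involution `w`. -/
theorem soloBlind_fixedRestrict_equivariant {n : ℕ} (w : Equiv.Perm (Fin n))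
    (hw : ∀ x, w (w x) = x) (T : Matrix (Fin n) (Fin n) (ZMod 2))
    (hT : ∀ y x, T (w y) (w x) = T y x) (c : Fin n → ZMod 2) (hc : ∀ x, c (w x) = c x)
    (y : Fin n) (hy : w y = y) :
    (T.mulVec c) y = ∑ x ∈ univ.filter (fun x => w x = x), T y x * c x := by
  have hTy : ∀ x, T y (w x) = T y x := by
    intro x
    have h := hT y x
    rw [hy] at h
    exact h
  have key : ∑ x ∈ univ.filter (fun x => ¬ w x = x), T y x * c x = 0 :=
    soloBlind_sum_nonfixed_eq_zero w hw (fun x => T y x * c x) (by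
      intro x
      show T y (w x) * c (w x) = T y x * c x
      rw [hTy, hc])
  have hsplit := Finset.sum_filter_add_sum_filter_not (univ : Finset (Fin n))
    (fun x => w x = x) (fun x => T y x * c x)
  rw [key, add_zero] at hsplit
  rw [hsplit]
  rfl

end Summit.Langlands.Langlands.Theorems
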